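import Literature.MathematicalPhysics.QuantumLattice.HubbardNNNHoppingFluxThermal
import HarnessLib

/-!
# No stiffness above `T*`: twist-insensitivity of the grand-canonical free energy of the
# `t–t'` Hubbard torus at high temperature, uniformly in `U` (pub-hubbard BOUNDS, Theorem 12)

HONEST FRAMING: ladder R1–R4 with certified numbers; no claim on H/H₀. These are rigorous bounds
for a MODEL CLASS (the `t–t'` Hubbard torus at any chemical potential), no materials claim.

Cell tree `Summits/HubbardSuperconductivity/HubbardLadder/Bounds/` (programme-internal statements;
nothing here is a cited Literature fact). bounds.tex §12 (bounds g23, 2026-08-21):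

* `kpBarLHS` — the left side of the one-parameter Kotecký–Preiss condition of bounds.tex
  Definition 12.1 in CLOSED form, `KP̄(y;a,b) : 16 y e^{4y} (e^{a+b+8y} + a)² ≤ a` with
  `y = β(|t|+|t'|)` (`t = 1` in the tree's torus): no square root, no series (the Catalan generating
  function `c = 1 + s c²` turns the series form `e^{a+b+8y} Σ_k C_k s^k ≤ a` into it).
* `HighTemperatureTwistInsensitivityTT'` (`@[conjecture] def`, PAPER-PROVED, bounds.tex Thm 12(i)
  at `η = 0`; NOT yet kernel-proved — no `_holds` in this file): for `L ≥ 3`, every `t'`, `U`, `μ`,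
  `β > 0`, `a > 0`, `b ≥ 0` with `kpBarLHS (β(1+|t'|)) a b ≤ a`, and EVERY seam twist `θ`,
  `|log Z(0) - log Z(θ)| ≤ 2a L² e^{-bL}` for the grand-canonical partition function
  `Z(θ) = tr_{Fock} e^{-β(hubbardTorusTT'Flux L t' U θ - μ N)}`. Proof in print: Ueltschi's
  polymer expansion (`Ueltschi1999` §2.3; tree `HubbardPolymerRepresentation`,
  `partitionFn_eq_mul_polymerPartitionFunction` for uniform couplings) with the Hölder activity
  bound uniform in the on-site terms (`Simon2005TraceIdeals` Thm 2.8), the plane-tree (Catalan)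
  entropy bound, the `d`-weighted Kotecký–Preiss tail estimate (`KoteckyPreiss1986` (4); tree
  `koteckyPreiss_truncatedWeight_bound`, `polymerLogZ_eq_sum_truncatedWeight`, PROVED) and the
  COLUMN LEMMA: a `U(1)` twist is a pure gauge on every polymer missing a column of the torus
  (`[v_x, n_x] = 0`), so only clusters of total size `≥ L` see the twist.
* `HighTemperatureNoThermalStiffnessTT'` (`@[conjecture] def`) — the stiffness reading,
  bounds.tex Thm 12(ii): under the same hypotheses every flux stiffness `ρ_s` of the
  grand-canonical free energy (`β ρ_s θ² ≤ log Z(0) - log Z(θ)` on `|θ| ≤ θ₀`, the hypothesis shape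
  of `thermalStiffnessTT'_mul_sq_le_kinetic`) obeys `ρ_s ≤ 2a L² e^{-bL} / (β θ₀²)`; PROVED from
  the insensitivity node (`highTemperatureNoThermalStiffnessTT'_of_insensitivity`).
* `kpBarLHS_inst160` — the Lean-CERTIFIED instance `KP̄(1/160; 0.377, 1/1000)` (third
  implementation of EXTREMISERS.md §5w instance I1, after the float and exact-rational ones):
  `T ≥ 160(|t|+|t'|)` is inside the Kotecký–Preiss domain with decay rate `b = 10⁻³ > 0`; whence
  the node `HighTemperatureNoThermalStiffnessTT'At160` (`@[conjecture] def`): for `β(1+|t'|) ≤ 1/160`,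
  `ρ_s ≤ 0.754 L² e^{-L/1000}/(β θ₀²)` for every `U`, `μ`, `θ₀` — PROVED from the insensitivity node
  (`highTemperatureNoThermalStiffnessTT'At160_of_insensitivity`).

What the reading gives (paper, Thm 12(v)): above `T₀ = 160(|t|+|t'|)` every stiffness functional
→ 0 as `L → ∞`, uniformly in `U ∈ ℝ`, `μ`; hence ANY stiffness-defined `T_c` (Nelson–Kosterlitz
`NK_q` for any `q`, or positivity of `limsup_L D_L`) satisfies `T_c ≤ 160(|t|+|t'|)` with NO
hypothesis — qualitative (three orders above the NK-conditional ceilings `≈ 0.3t`; a convergent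
high-temperature expansion uniform in `U` is capped at `T* ≍ |t|`) but unconditional.
Grand-canonical ensemble only (the polymer gas uses `Π_x tr e^{-β v_x}`); the canonical-sector
version is open.

References: D. Ueltschi, J. Stat. Phys. 95 (1999) 693 (arXiv:cond-mat/9810320) §2.3, Thm 3.1;
R. Kotecký, D. Preiss, Comm. Math. Phys. 103 (1986) 491; B. Simon, Trace ideals (2005) Thm 2.8;
H. Araki, H. Moriya, Rev. Math. Phys. 15 (2003) 93, Prop. 4.6; bounds.tex §12; EXTREMISERS.md §5w.
-/

noncomputable section

namespace Summit.HubbardSuperconductivity.HubbardLadder.Bounds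

open Matrix Literature.MathematicalPhysics.QuantumLattice
  Literature.MathematicalPhysics.QuantumFieldTheory
open scoped ComplexConjugate ComplexOrder

/-! ### The Kotecký–Preiss condition (closed form) -/

/-- The left-hand side of the one-parameter Kotecký–Preiss condition `KP̄(y; a, b)` of
bounds.tex Definition 12.1 at `η = 0` (closed form): `16 y e^{4y} (e^{a+b+8y} + a)²`,
`y = β(|t|+|t'|)`; the condition is `kpBarLHS y a b ≤ a`. It implies the series form
`s ≤ 1/4 ∧ e^{a+b+8y} Σ_{k≥1} C_k s^k ≤ a`, `s = 16 y e^{4y} e^{a+b+8y}` (Catalan numbers), which is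
what the cluster expansion consumes. -/
def kpBarLHS (y a b : ℝ) : ℝ :=
  16 * y * Real.exp (4 * y) * (Real.exp (a + b + 8 * y) + a) ^ 2

/-- The grand-canonical `t–t'` torus Hamiltonian with seam twist `θ` at chemical potential `μ`:
`hubbardTorusTT'Flux L t' U θ - μ N` (`t = 1`). -/
def hubbardTorusTT'FluxMu (L : ℕ) [NeZero L] (t' U μ θ : ℝ) :
    Matrix (Finset (Orb (FermionTorus 2 L))) (Finset (Orb (FermionTorus 2 L))) ℂ :=
  hubbardTorusTT'Flux L t' U θ - (μ : ℂ) • totalNumber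

/-! ### The statements -/

/-- **Twist insensitivity at high temperature** (bounds.tex Thm 12(i), `η = 0`; PAPER-PROVED,
not yet kernel-proved). For `L ≥ 3`, all `t' U μ : ℝ`, `β > 0`, `a > 0`, `b ≥ 0` with
`kpBarLHS (β(1+|t'|)) a b ≤ a`: for every seam twist `θ`,
`|log Re Z(0) - log Re Z(θ)| ≤ 2a L² e^{-bL}`, `Z(θ) = partitionFn β (hubbardTorusTT'FluxMu L t' U μ θ)`
(full Fock space = grand-canonical ensemble). Why it might fail as typed: only if the paper proof
(bounds.tex §12: polymer representation, Hölder activity bound, Catalan entropy, Kotecký–Preiss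
with `d(A) = b|A|`, column gauge lemma) has a gap; the constants `16`, `4`, `8` are those of the
`t–t'` torus (8 neighbours, 4 directed spin-bonds per edge). -/
@[conjecture] def HighTemperatureTwistInsensitivityTT' : Prop :=
  ∀ (L : ℕ) [NeZero L], 3 ≤ L → ∀ (t' U μ β a b : ℝ), 0 < β → 0 < a → 0 ≤ b →
    kpBarLHS (β * (1 + |t'|)) a b ≤ a →
    ∀ θ : ℝ,
      |Real.log (partitionFn β (hubbardTorusTT'FluxMu L t' U μ 0)).re -
          Real.log (partitionFn β (hubbardTorusTT'FluxMu L t' U μ θ)).re| ≤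
        2 * a * (L : ℝ) ^ 2 * Real.exp (-(b * L))

/-- **No thermal stiffness above `T*`** (bounds.tex Thm 12(ii)). Under the hypotheses of
`HighTemperatureTwistInsensitivityTT'`, every flux stiffness `ρ_s` of the grand-canonical free
energy — `β ρ_s θ² ≤ log Re Z(0) - log Re Z(θ)` for `|θ| ≤ θ₀`, `θ₀ > 0` — satisfies
`ρ_s ≤ 2a L² e^{-bL} / (β θ₀²)` (→ 0 as `L → ∞` whenever `b > 0`, uniformly in `U`, `μ`). PROVED from
the insensitivity node below. -/
@[conjecture] def HighTemperatureNoThermalStiffnessTT' : Prop :=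
  ∀ (L : ℕ) [NeZero L], 3 ≤ L → ∀ (t' U μ β a b ρs θ₀ : ℝ), 0 < β → 0 < a → 0 ≤ b → 0 < θ₀ →
    kpBarLHS (β * (1 + |t'|)) a b ≤ a →
    (∀ θ : ℝ, |θ| ≤ θ₀ → β * ρs * θ ^ 2 ≤
        Real.log (partitionFn β (hubbardTorusTT'FluxMu L t' U μ 0)).re -
          Real.log (partitionFn β (hubbardTorusTT'FluxMu L t' U μ θ)).re) →
    ρs ≤ 2 * a * (L : ℝ) ^ 2 * Real.exp (-(b * L)) / (β * θ₀ ^ 2)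

/-- **Reduction** (bounds.tex Thm 12 (i) ⇒ (ii)): twist insensitivity implies the vanishing bound
on every flux stiffness — evaluate the stiffness hypothesis at `θ = θ₀` and divide by `β θ₀² > 0`. -/
theorem highTemperatureNoThermalStiffnessTT'_of_insensitivity
    (h : HighTemperatureTwistInsensitivityTT') : HighTemperatureNoThermalStiffnessTT' := by
  intro L _ hL t' U μ β a b ρs θ₀ hβ ha hb hθ₀ hkp hstiff
  have hins := h L hL t' U μ β a b hβ ha hb hkp θ₀
  have hE := hstiff θ₀ (by rw [abs_of_pos hθ₀])
  have hpos : 0 < β * θ₀ ^ 2 := mul_pos hβ (pow_pos hθ₀ 2)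
  rw [le_div_iff₀ hpos]
  calc ρs * (β * θ₀ ^ 2) = β * ρs * θ₀ ^ 2 := by ring
    _ ≤ _ := hE
    _ ≤ _ := le_abs_self _
    _ ≤ _ := hins

/-! ### A certified instance of the Kotecký–Preiss condition: `T ≥ 160 (|t| + |t'|)` -/

/-- **Certified instance I1 of EXTREMISERS.md §5w**: `KP̄(1/160; a = 0.377, b = 1/1000)` holds,
i.e. `T ≥ 160(|t|+|t'|)` lies in the Kotecký–Preiss domain of Theorem 12 with a positive decay
rate (kernel arithmetic: Taylor upper bounds for the two exponentials, then `norm_num`). -/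
theorem kpBarLHS_inst160 : kpBarLHS (1 / 160) (377 / 1000) (1 / 1000) ≤ 377 / 1000 := by
  unfold kpBarLHS
  -- Taylor upper bound `e^x ≤ 1 + x + x²/2 + (2/9) x³` on `[0, 1]`, inline from Mathlib's
  -- `Real.exp_bound'` (three terms); the same inequality is the tree's
  -- `…Balaban1983to89.B8Eq146AExpansion.exp_le_taylor3` (not imported here: unrelated import chain).
  have tay : ∀ x : ℝ, 0 ≤ x → x ≤ 1 → Real.exp x ≤ 1 + x + x ^ 2 / 2 + 2 / 9 * x ^ 3 := by
    intro x hx0 hx1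
    have h := Real.exp_bound' hx0 hx1 (n := 3) (by norm_num)
    simp only [Finset.sum_range_succ, Finset.sum_range_zero, Nat.factorial, pow_zero, pow_one,
      Nat.cast_one, Nat.cast_ofNat] at h
    norm_num at h
    linarith
  have h1 : Real.exp (4 * (1 / 160 : ℝ)) ≤ 1 + 4 * (1 / 160 : ℝ) + (4 * (1 / 160 : ℝ)) ^ 2 / 2 +
      2 / 9 * (4 * (1 / 160 : ℝ)) ^ 3 := tay _ (by norm_num) (by norm_num)
  have h2 : Real.exp (377 / 1000 + 1 / 1000 + 8 * (1 / 160 : ℝ)) ≤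
      1 + (377 / 1000 + 1 / 1000 + 8 * (1 / 160 : ℝ)) +
        (377 / 1000 + 1 / 1000 + 8 * (1 / 160 : ℝ)) ^ 2 / 2 +
          2 / 9 * (377 / 1000 + 1 / 1000 + 8 * (1 / 160 : ℝ)) ^ 3 :=
    tay _ (by norm_num) (by norm_num)
  have h0 : 0 ≤ Real.exp (377 / 1000 + 1 / 1000 + 8 * (1 / 160 : ℝ)) + 377 / 1000 := by positivity
  calc 16 * (1 / 160 : ℝ) * Real.exp (4 * (1 / 160)) *
        (Real.exp (377 / 1000 + 1 / 1000 + 8 * (1 / 160)) + 377 / 1000) ^ 2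
      ≤ 16 * (1 / 160 : ℝ) * (1 + 4 * (1 / 160 : ℝ) + (4 * (1 / 160 : ℝ)) ^ 2 / 2 +
            2 / 9 * (4 * (1 / 160 : ℝ)) ^ 3) *
          (1 + (377 / 1000 + 1 / 1000 + 8 * (1 / 160 : ℝ)) +
              (377 / 1000 + 1 / 1000 + 8 * (1 / 160 : ℝ)) ^ 2 / 2 +
                2 / 9 * (377 / 1000 + 1 / 1000 + 8 * (1 / 160 : ℝ)) ^ 3 + 377 / 1000) ^ 2 := by
        gcongr
    _ ≤ 377 / 1000 := by norm_num

/-- Monotonicity of `KP̄` in `y`: the left side is non-decreasing in `y ≥ 0` (for `a ≥ 0`), so the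
condition persists as the temperature increases (`y = β(|t|+|t'|)` decreases). -/
theorem kpBarLHS_mono {y y' a b : ℝ} (hy' : 0 ≤ y') (hyy : y' ≤ y) (ha : 0 ≤ a) :
    kpBarLHS y' a b ≤ kpBarLHS y a b := by
  unfold kpBarLHS
  have hy : 0 ≤ y := hy'.trans hyy
  have h0 : 0 ≤ Real.exp (a + b + 8 * y') + a := by positivity
  gcongr

/-- **No thermal stiffness at and above `T = 160(|t|+|t'|)`** (bounds.tex Thm 12(iv)–(v), the
certified reading): for `L ≥ 3`, every `t'`, `U`, `μ`, every `β > 0` with `β(1+|t'|) ≤ 1/160`, every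
`θ₀ > 0` and every flux stiffness `ρ_s` of the grand-canonical free energy on `|θ| ≤ θ₀`:
`ρ_s ≤ 0.754 L² e^{-L/1000} / (β θ₀²)` — uniformly in `U`, `μ`; in particular `ρ_s → 0` as `L → ∞`.
PROVED below from the (paper-proved) insensitivity node and the certified instance
`kpBarLHS_inst160`. -/
@[conjecture] def HighTemperatureNoThermalStiffnessTT'At160 : Prop :=
  ∀ (L : ℕ) [NeZero L], 3 ≤ L → ∀ (t' U μ β ρs θ₀ : ℝ), 0 < β → 0 < θ₀ →
    β * (1 + |t'|) ≤ 1 / 160 →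
    (∀ θ : ℝ, |θ| ≤ θ₀ → β * ρs * θ ^ 2 ≤
        Real.log (partitionFn β (hubbardTorusTT'FluxMu L t' U μ 0)).re -
          Real.log (partitionFn β (hubbardTorusTT'FluxMu L t' U μ θ)).re) →
    ρs ≤ 2 * (377 / 1000) * (L : ℝ) ^ 2 * Real.exp (-(1 / 1000 * L)) / (β * θ₀ ^ 2)

/-- **Reduction**: the insensitivity node implies the certified `T ≥ 160(|t|+|t'|)` reading
(monotonicity of `KP̄` in `y` + the kernel-certified instance `kpBarLHS_inst160`). -/
theorem highTemperatureNoThermalStiffnessTT'At160_of_insensitivity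
    (h : HighTemperatureTwistInsensitivityTT') : HighTemperatureNoThermalStiffnessTT'At160 := by
  intro L _ hL t' U μ β ρs θ₀ hβ hθ₀ hT hstiff
  have hy : 0 ≤ β * (1 + |t'|) := by positivity
  have hkp : kpBarLHS (β * (1 + |t'|)) (377 / 1000) (1 / 1000) ≤ 377 / 1000 :=
    (kpBarLHS_mono hy hT (by norm_num)).trans kpBarLHS_inst160
  exact highTemperatureNoThermalStiffnessTT'_of_insensitivity h L hL t' U μ β (377 / 1000)
    (1 / 1000) ρs θ₀ hβ (by norm_num) (by norm_num) hθ₀ hkp hstiff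

end Summit.HubbardSuperconductivity.HubbardLadder.Bounds

end
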